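import Summits.HodgeConjecture.HodgeConjecture.Theorems.R90S3AuxGlobaliseChar           -- ★ p863377: `cpt`, `unitIdelesAway` (TorusLocalDatum), `piUnits_symm_mulSingle_piUnits`, T1
import Literature.NumberTheory.Rogawski1990.LocalTransferAtOneMuTwistGlobal               -- ★ `isUnramifiedAt_quadraticHeckeCharCM_of_isUnramifiedIn`
import Literature.NumberTheory.GaloisRepresentations.IdeleClassBarSLayerKernel            -- ★ `valued_ideleBaseChange_apply`, `SemiLocal.withZero_pow_eq_one_iff`
import Literature.NumberTheory.GaloisRepresentations.HeckeCharacterExtensionQuadraticArchProofs  -- ★ `principalIdele_algebraMap`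
import HarnessLib

/-!
# R90-TF · S3 · THEOREMS — `R90S3QuadraticCharUnramifiedOff` ((U3-χ) brick B1, file F2 of 3): the quadratic character `ω = ε_{L∕L⁺}` off the
# distinguished place, and the KERNEL STEP of the key of Weil's extension principle (triples `a_L · y = (k)` with `k = k̄`)

R90-TF section S3 (successor dealer R90-C12-plan (g2), RULING S3-R24 2026-09-05T00:07:10Z «(B1) → K2E3-p21», the dealer's suggested cut «ω′ trivial on unit
idèles off v′ under `hur′`»; census + road R90 bus 00:17:35Z); crux H413 (`stmt-HodgeConjecture-24833`, lane `--supports … --as helper`), route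
`HCCMUnconditional`.  Consumer: file F3 `Theorems/R90S3AuxGlobaliseCharKey.lean` (`exists_odd_key_of_infCharFamily` = the `hKey` binder of ★ p863377
`auxGlobaliseChar_of_key` behind the (U3-χ) socket `stub_R90_S3_auxGlobaliseChar` of `Cruxes/H413/Lines/R90_S3_LocalTransportWaveG.lean` :669).
THEOREMS ONLY (no `def`, no `instance`, no notation, no named fact, no `sorry`); ★ imports only; never imports `Cruxes/…/Lines`.

THE MATHEMATICS [Rogawski1990 §13.8 p. 216; Weil1956 §1; CasselsFrohlichANT1967 Ch. VII §§1–6].  `L` a CM field, `ω = ε_{L∕L⁺}` its quadratic Hecke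
character (★ `quadraticHeckeCharCM`), `v` a finite place of `L⁺`, `w ∣ v` the unique place of `L` above it when `v` does not split (`c • w = w`).
(§1–§2) If `L∕L⁺` is unramified at every finite place `u ≠ v` (the (U3-F) socket's ⟪U⟫-field clause `hur′`, stated over `PlacesOver`), then `ω` is
UNRAMIFIED at every `u ≠ v` (★ `isUnramifiedAt_quadraticHeckeCharCM_of_isUnramifiedIn`, dyadic places included) and hence kills every idèle of `L⁺` that is
a local unit everywhere, `1` at `∞` and `1` at `v` (★ density lemma `map_eq_one_of_isUnramifiedAt_off`).  (§3) LOCAL MATCH AT `v`: for `β ∈ L⁺_vˣ` and a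
character `χ` of `(L ⊗ L⁺_v)ˣ` of `ω`-TYPE (★ `IsQuadraticCharExtension`: trivial on a `σ_v`-fixed unit iff it is a norm `σ_v z · z`),
`ω(⟨β⟩_v) · χ(ι_v β) = 1` — both factors are `±1` with the SAME kernel «`β` is a local norm from `L_w`» (★ `quadraticHeckeChar_localUnits_eq_one_iff_mem`, ★
`exists_mul_conjLocal_eq_toLocalRing_iff`).  (§4–§5) Bookkeeping: the components of a base-changed idèle above `v` (`(a_L)_w = ι_w(a_v)`), descent of
unit valuations along `L∕L⁺`, and the reading `blk_w(a_L) = ι_v(a_v)` of the `w`-block at a non-split place.  (§6) THE KERNEL STEP OF THE KEY: for an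
admissible triple `a_L · y = (k)` (`a ∈ 𝕀_{L⁺}`, `y ∈ 𝕌_L^{(w)}`, `k ∈ Lˣ`) with `k̄ = k`, i.e. `k ∈ L⁺` (Mathlib `IsCMField.complexConj_eq_self_iff`), one has
`y = b_L` with `b = a⁻¹ (k)_{L⁺}` a unit off `v`, and for ANY archimedean character `Φ_∞` agreeing with `ω_∞` on `(L⁺ ⊗ ℝ)ˣ`:
`ω(a) · Φ_∞(y_∞) · χ(blk_w y) = ω(b)⁻¹ · ω(b_∞) · χ(ι_v b_v) = [ω(b_∞) ω(⟨b_v⟩) ω(b^{∞,v})]⁻¹ ω(b_∞) χ(ι_v b_v) = 1`.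
* §1 `isUnramifiedIn_of_forall_placesOver`; §2 `quadraticHeckeCharCM_eq_one_of_unit_off`; §3 `units_val_mul_eq_one_of_sq`,
  **`quadraticHeckeCharCM_localUnits_mul_eq_one`**; §4 `ideleBaseChange_snd_placesOver`, `valued_snd_under_eq_one_of_ideleBaseChange`,
  `valued_snd_eq_one_of_ideleBaseChange_mem_unitIdelesAway`; §5 `piUnits_symm_mulSingle_cpt_ideleBaseChange`, `piUnits_symm_mulSingle_cpt_semilocalUnits`;
  §6 **`key_of_complexConj_eq`**.

HONEST LABEL: HC_CM is proved only modulo the 7 printed citations (2 remaining named inputs: hLiu418 = stmt-HodgeConjecture-24832, h413 =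
stmt-HodgeConjecture-24833) until rung 0 closes; arithmetic toward a GENUINE residual ((U3-χ)); proves nothing printed; count-neutral.

## References
* [Rogawski1990] J. D. Rogawski, *Automorphic Representations of Unitary Groups in Three Variables*, Ann. of Math. Stud. 123 (1990), §13.8 p. 216.
* [Weil1956] A. Weil, *On a certain type of characters of the idèle-class group of an algebraic number-field* (1956), §1.
* [CasselsFrohlichANT1967] J. W. S. Cassels, A. Fröhlich (eds.), *Algebraic Number Theory* (1967), Ch. VII §§1–6.
* [Omeara1963] O. T. O'Meara, *Introduction to Quadratic Forms* (1963), §63C Example 63:16, §65A Example 65:2.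
-/

set_option autoImplicit false
-- the mandated namespace repeats the single-problem summit's segment (`HodgeConjecture.HodgeConjecture`)
set_option linter.dupNamespace false

noncomputable section

namespace Summit.HodgeConjecture.HodgeConjecture.R90.S3

open NumberField IsDedekindDomain
open Literature.NumberTheory.GaloisRepresentations Literature.NumberTheory.GaloisRepresentations.HeckeCharacter
open Literature.NumberTheory.GaloisRepresentations.HeckeCharacter.CMQuadraticExtension
open Literature.NumberTheory.Automorphic IdeleHerbrand Literature.NumberTheory.Automorphic.UnitaryGroup
open Literature.NumberTheory.Automorphic.Arthur2013.Leaves.TECR.TorusDict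
open Literature.NumberTheory.Rogawski1990

variable (L : Type) [Field L] [NumberField L] [IsCMField L] (v : HeightOneSpectrum (𝓞 ↥(maximalRealSubfield L)))

/-! ## §1 `PlacesOver` form of «`v` is unramified in `L`» -/

omit [NumberField L] [IsCMField L] in
/-- «`L∕L⁺` is unramified at every place `W` of `L` over `v`» (the (U3-F) socket's `PlacesOver` spelling) gives Mathlib's `Algebra.IsUnramifiedIn (𝓞 L) v`
(a prime of `𝓞 L` over `v ≠ 0` is non-zero, i.e. a place over `v`). [cite: CasselsFrohlichANT1967, Ch. I §5] -/
theorem isUnramifiedIn_of_forall_placesOver {v : HeightOneSpectrum (𝓞 ↥(maximalRealSubfield L))}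
    (h : ∀ W : UnitaryGroup.PlacesOver L v, Algebra.IsUnramifiedAt (𝓞 ↥(maximalRealSubfield L)) W.1.asIdeal) :
    Algebra.IsUnramifiedIn (𝓞 L) v.asIdeal := by
  intro P hP hover
  have hne : P ≠ ⊥ := Ideal.ne_bot_of_liesOver_of_ne_bot v.ne_bot P
  exact h ⟨⟨P, hP, hne⟩, HeightOneSpectrum.ext (by rw [HeightOneSpectrum.under_asIdeal]; exact hover.over.symm)⟩

/-! ## §2 `ω` kills the unit idèles off `v` (trivial at `∞` and at `v`) -/

/-- **`ω(z) = 1` for `z ∈ 𝕌_{L⁺}` with `z_∞ = 1`, `z_v = 1`**, when `L∕L⁺` is unramified at every finite `u ≠ v` (`hur`): `ω` is then unramified at every `u ≠ v`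
(★ `isUnramifiedAt_quadraticHeckeCharCM_of_isUnramifiedIn`, dyadic `u` included) and the density lemma ★ `map_eq_one_of_isUnramifiedAt_off` applies with the
exceptional set `{v}`. [cite: Rogawski1990, §13.8 p. 216] [cite: Omeara1963, §63C Example 63:16] -/
theorem quadraticHeckeCharCM_eq_one_of_unit_off
    (hur : ∀ u : HeightOneSpectrum (𝓞 ↥(maximalRealSubfield L)), u ≠ v → ∀ W : UnitaryGroup.PlacesOver L u,
      Algebra.IsUnramifiedAt (𝓞 ↥(maximalRealSubfield L)) W.1.asIdeal)
    (z : ideleGroup ↥(maximalRealSubfield L)) (hz1 : (z : AdeleRing (𝓞 ↥(maximalRealSubfield L)) ↥(maximalRealSubfield L)).1 = 1)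
    (hzu : z ∈ unitIdeles ↥(maximalRealSubfield L)) (hzv : (z : AdeleRing (𝓞 ↥(maximalRealSubfield L)) ↥(maximalRealSubfield L)).2 v = 1) :
    quadraticHeckeCharCM L z = 1 := by
  classical
  refine map_eq_one_of_isUnramifiedAt_off (quadraticHeckeCharCM L) {v} (fun u hu => ?_) z hz1 hzu (fun u hu => ?_)
  · exact isUnramifiedAt_quadraticHeckeCharCM_of_isUnramifiedIn L
      (isUnramifiedIn_of_forall_placesOver L (hur u (fun h => hu (Finset.mem_singleton.2 h))))
  · rw [Finset.mem_singleton.1 hu]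
    exact hzv

/-! ## §3 The local match at `v`: `ω(⟨β⟩_v) · χ(ι_v β) = 1` -/

/-- Two square roots of `1` in `ℂˣ` with the same triviality are reciprocal: `p² = q² = 1`, `(p = 1 ↔ q = 1)` ⇒ `p q = 1`. [folklore] -/
theorem units_val_mul_eq_one_of_sq {p q : ℂˣ} (hp : p ^ 2 = 1) (hq : q ^ 2 = 1) (h : p = 1 ↔ q = 1) : (p : ℂ) * q = 1 := by
  have hp' : (p : ℂ) = 1 ∨ (p : ℂ) = -1 := by
    rw [← mul_self_eq_one_iff, ← pow_two, ← Units.val_pow_eq_pow_val, hp, Units.val_one]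
  have hq' : (q : ℂ) = 1 ∨ (q : ℂ) = -1 := by
    rw [← mul_self_eq_one_iff, ← pow_two, ← Units.val_pow_eq_pow_val, hq, Units.val_one]
  have h1 : (p : ℂ) = 1 ↔ (q : ℂ) = 1 := by rw [Units.val_eq_one, Units.val_eq_one]; exact h
  rcases hp' with hp1 | hp1
  · rw [hp1, h1.1 hp1, mul_one]
  · rcases hq' with hq1 | hq1
    · exact absurd (h1.2 hq1) (by rw [hp1]; norm_num)
    · rw [hp1, hq1]; norm_num

/-- **THE LOCAL MATCH AT `v`.**  For `β ∈ L⁺_vˣ` and a character `χ` of `(L ⊗ L⁺_v)ˣ` of `ω`-type (★ `IsQuadraticCharExtension (σ ⊗ 1) χ`):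
`ω(⟨β⟩_v) · χ(ι_v β) = 1`.  Both factors square to `1` (★ `quadraticHeckeCharCM_apply_sq`; `(ι_v β)² = σ(ι_v β) · ι_v β` is a norm) and both are `1` exactly when
`β` is a local norm from `L_w` (★ `quadraticHeckeChar_localUnits_eq_one_iff_mem` — Hilbert reciprocity inside — and ★ `exists_mul_conjLocal_eq_toLocalRing_iff`).
[cite: Rogawski1990, §4.8 p. 51; §13.8 p. 216] [cite: Omeara1963, §65A Example 65:2] -/
theorem quadraticHeckeCharCM_localUnits_mul_eq_one (χ : (UnitaryGroup.LocalRing L v)ˣ →* ℂˣ)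
    (hχ : IsQuadraticCharExtension (conjLocal L (IsCMField.complexConj L) v) χ)
    (β : (v.adicCompletion ↥(maximalRealSubfield L))ˣ) :
    ((quadraticHeckeCharCM L (localUnits v β) : ℂˣ) : ℂ) *
      χ (Units.map (UnitaryGroup.toLocalRing L v : v.adicCompletion ↥(maximalRealSubfield L) →* UnitaryGroup.LocalRing L v) β) = 1 := by
  set x : (UnitaryGroup.LocalRing L v)ˣ :=
    Units.map (UnitaryGroup.toLocalRing L v : v.adicCompletion ↥(maximalRealSubfield L) →* UnitaryGroup.LocalRing L v) β with hx
  have hxv : (x : UnitaryGroup.LocalRing L v) = UnitaryGroup.toLocalRing L v (β : v.adicCompletion ↥(maximalRealSubfield L)) := rfl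
  have hfix : conjLocal L (IsCMField.complexConj L) v (x : UnitaryGroup.LocalRing L v) = x := by
    rw [hxv, conjLocal_toLocalRing]
  refine units_val_mul_eq_one_of_sq (quadraticHeckeCharCM_apply_sq _) ?_ ?_
  · -- `χ(x)² = χ(σ x · x) = 1`
    rw [← map_pow, (hχ (x ^ 2) (by rw [Units.val_pow_eq_pow_val, map_pow, hfix])).2 ⟨x, by rw [hfix, Units.val_pow_eq_pow_val, pow_two]⟩]
  · -- same kernel: «`β` is a local norm»
    rw [quadraticHeckeCharCM_def, quadraticHeckeChar_localUnits_eq_one_iff_mem, ← exists_mul_conjLocal_eq_toLocalRing_iff, hχ x hfix, ← hxv]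
    constructor
    · rintro ⟨z, hz⟩
      have hzu : IsUnit z :=
        isUnit_of_mul_isUnit_left (y := conjLocal L (IsCMField.complexConj L) v z) (by rw [hz]; exact x.isUnit)
      exact ⟨hzu.unit, by rw [IsUnit.unit_spec, mul_comm]; exact hz⟩
    · rintro ⟨y, hy⟩
      exact ⟨y, by rw [mul_comm]; exact hy⟩

/-! ## §4 Components of a base-changed idèle above `v`; descent of unit valuations -/

omit [IsCMField L] in
/-- **`(a_L)_w = ι_w(a_v)`** for a place `w ∣ v` of `L` and an idèle `a` of `L⁺` (★ `FiniteAdeleRing.baseChange_apply` + ★ `adicCompletionOfUnder_eq`; `ι_w` = ★ `toPlace v w`).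
[cite: CasselsFrohlichANT1967, Ch. II §14] -/
theorem ideleBaseChange_snd_placesOver (a : ideleGroup ↥(maximalRealSubfield L)) (w : UnitaryGroup.PlacesOver L v) :
    ((AdeleRing.ideleBaseChange ↥(maximalRealSubfield L) L a : ideleGroup L) : AdeleRing (𝓞 L) L).2 w.1 =
      UnitaryGroup.toPlace v w ((a : AdeleRing (𝓞 ↥(maximalRealSubfield L)) ↥(maximalRealSubfield L)).2 v) := by
  haveI := UnitaryGroup.PlacesOver.liesOver w
  rw [AdeleRing.coe_ideleBaseChange, AdeleRing.baseChange_snd, FiniteAdeleRing.baseChange_apply, adicCompletionOfUnder_eq (↥(maximalRealSubfield L)) w.1 w.2]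
  rfl

omit [IsCMField L] in
/-- **Descent of unit valuations**: if `|(a_L)_W|_W = 1` then `|a_u|_u = 1` for `u = W ∩ L⁺` (`|(a_L)_W| = |a_u|^{e}` with `e ≠ 0`, ★ `valued_ideleBaseChange_apply`).
[cite: CasselsFrohlichANT1967, Ch. VII §1.1] -/
theorem valued_snd_under_eq_one_of_ideleBaseChange {a : ideleGroup ↥(maximalRealSubfield L)} {W : HeightOneSpectrum (𝓞 L)}
    (h : Valued.v (((AdeleRing.ideleBaseChange ↥(maximalRealSubfield L) L a : ideleGroup L) : AdeleRing (𝓞 L) L).2 W) = 1) :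
    Valued.v ((a : AdeleRing (𝓞 ↥(maximalRealSubfield L)) ↥(maximalRealSubfield L)).2 (W.under (𝓞 ↥(maximalRealSubfield L)))) = 1 := by
  rw [IdeleCohomology.valued_ideleBaseChange_apply] at h
  haveI : W.asIdeal.LiesOver (W.under (𝓞 ↥(maximalRealSubfield L))).asIdeal := ⟨rfl⟩
  have he : (W.under (𝓞 ↥(maximalRealSubfield L))).asIdeal.ramificationIdx' W.asIdeal ≠ 0 :=
    Ideal.IsDedekindDomain.ramificationIdx'_ne_zero_of_liesOver W.asIdeal (W.under (𝓞 ↥(maximalRealSubfield L))).ne_bot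
  have h0 : Valued.v ((a : AdeleRing (𝓞 ↥(maximalRealSubfield L)) ↥(maximalRealSubfield L)).2 (W.under (𝓞 ↥(maximalRealSubfield L)))) ≠ 0 := by
    intro h0
    rw [h0, zero_pow he] at h
    exact zero_ne_one h
  exact (SemiLocal.withZero_pow_eq_one_iff h0 he).1 h

omit [IsCMField L] in
/-- **`a_L ∈ 𝕌_L^{(w)}` ⇒ `|a_u|_u = 1` for every finite `u ≠ v`** (`w ∣ v`): choose a place `W ∣ u` of `L` (★ `HeightOneSpectrum.under_surjective`); `W ≠ w` since
`u ≠ v`, so `|(a_L)_W| = 1`, and descend. [cite: CasselsFrohlichANT1967, Ch. VII §1.1] -/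
theorem valued_snd_eq_one_of_ideleBaseChange_mem_unitIdelesAway (w : UnitaryGroup.PlacesOver L v) {a : ideleGroup ↥(maximalRealSubfield L)}
    (ha : AdeleRing.ideleBaseChange ↥(maximalRealSubfield L) L a ∈ unitIdelesAway w.1)
    {u : HeightOneSpectrum (𝓞 ↥(maximalRealSubfield L))} (hu : u ≠ v) :
    Valued.v ((a : AdeleRing (𝓞 ↥(maximalRealSubfield L)) ↥(maximalRealSubfield L)).2 u) = 1 := by
  obtain ⟨W, rfl⟩ := HeightOneSpectrum.under_surjective (A := 𝓞 ↥(maximalRealSubfield L)) (B := 𝓞 L) u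
  have hW : W ≠ w.1 := fun h => hu (by rw [h]; exact w.2)
  exact valued_snd_under_eq_one_of_ideleBaseChange L (ha W hW)

/-! ## §5 The `w`-block reading `blk_w` at a non-split place -/

open scoped Classical in
omit [IsCMField L] in
/-- **`blk_w(a_L) = ι_v(a_v)`**: at a place `v` with a single place `w` above it, reading the `w`-component of the base change `a_L` and re-inserting it into
`(L ⊗ L⁺_v)ˣ = (∏_{w ∣ v} L_w)ˣ` gives the diagonal image `ι_v(a_v)` (★ `toLocalRing`; `(a_L)_w = ι_w(a_v)`). [cite: CasselsFrohlichANT1967, Ch. II §10, §14] -/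
theorem piUnits_symm_mulSingle_cpt_ideleBaseChange (w : UnitaryGroup.PlacesOver L v) (hw : ∀ w' : UnitaryGroup.PlacesOver L v, w' = w)
    (a : ideleGroup ↥(maximalRealSubfield L)) :
    (MulEquiv.piUnits (M := fun w' : UnitaryGroup.PlacesOver L v => w'.1.adicCompletion L)).symm
        (Pi.mulSingle w (cpt w.1 (AdeleRing.ideleBaseChange ↥(maximalRealSubfield L) L a))) =
      Units.map (UnitaryGroup.toLocalRing L v : v.adicCompletion ↥(maximalRealSubfield L) →* UnitaryGroup.LocalRing L v) (cpt v a) := by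
  refine Units.ext (funext fun w' => ?_)
  obtain rfl := hw w'
  rw [MulEquiv.val_piUnits_symm_apply, Pi.mulSingle_eq_same, Units.coe_map, MonoidHom.coe_coe, UnitaryGroup.toLocalRing_apply]
  change ((AdeleRing.ideleBaseChange ↥(maximalRealSubfield L) L a : ideleGroup L) : AdeleRing (𝓞 L) L).2 w'.1 = _
  rw [ideleBaseChange_snd_placesOver]
  rfl

open scoped Classical in
omit [IsCMField L] in
/-- **`blk_w(u^{(v)}) = u`** for the block idèle `u^{(v)} = semilocalUnits v u` of `u ∈ (L ⊗ L⁺_v)ˣ` at a place with a single place `w` above it (★ `semilocalUnits_snd_apply_of_over`,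
★ `piUnits_symm_mulSingle_piUnits`). [cite: TateThesis1967, §3.2] -/
theorem piUnits_symm_mulSingle_cpt_semilocalUnits (w : UnitaryGroup.PlacesOver L v) (hw : ∀ w' : UnitaryGroup.PlacesOver L v, w' = w)
    (u : (UnitaryGroup.LocalRing L v)ˣ) :
    (MulEquiv.piUnits (M := fun w' : UnitaryGroup.PlacesOver L v => w'.1.adicCompletion L)).symm
        (Pi.mulSingle w (cpt w.1 (semilocalUnits L v u))) = u := by
  have hc : cpt w.1 (semilocalUnits L v u) = MulEquiv.piUnits (M := fun w' : UnitaryGroup.PlacesOver L v => w'.1.adicCompletion L) u w :=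
    Units.ext (by rw [MulEquiv.val_piUnits_apply]; exact semilocalUnits_snd_apply_of_over L u w)
  rw [hc]
  exact piUnits_symm_mulSingle_piUnits L v w hw u

/-! ## §6 THE KERNEL STEP of the key: triples `a_L · y = (k)` with `k̄ = k` -/

open scoped Classical in
/-- **THE KERNEL STEP OF THE KEY OF WEIL'S EXTENSION PRINCIPLE (twisted by `ω`).**  `L` CM, `v` a finite place of `L⁺` with a place `w ∣ v` fixed by complex
conjugation (so `w` is the ONLY place over `v`), `L∕L⁺` unramified at every finite `u ≠ v` (`hur`); `χ` a character of `(L ⊗ L⁺_v)ˣ` of `ω`-type (`hχ`, ★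
`IsQuadraticCharExtension`); `Φ_∞` ANY character of `(L ⊗ ℝ)ˣ` that agrees with `ω` on the base change of `(L⁺ ⊗ ℝ)ˣ` (`hΦ`).  Then for every admissible triple
`a_L · y = (k)` with `a ∈ 𝕀_{L⁺}`, `y ∈ 𝕌_L^{(w)}` and `k̄ = k`:  `ω(a) · Φ_∞(y_∞) · χ(blk_w y) = 1`.
PROOF: `k ∈ L⁺` (Mathlib `IsCMField.complexConj_eq_self_iff`), so `y = b_L` with `b := a⁻¹ (k)_{L⁺}` (★ `principalIdele_algebraMap`) and `ω(a) = ω(b)⁻¹`; write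
`b = b_∞ · ⟨b_v⟩_v · b′` with `b′ ∈ 𝕌_{L⁺}`, `b′_∞ = 1`, `b′_v = 1` (`b` is a unit off `v` because `b_L = y ∈ 𝕌^{(w)}`, §4), so `ω(b′) = 1` (§2); `Φ_∞(y_∞) = ω(b_∞)`
(`hΦ`); `blk_w(y) = ι_v(b_v)` (§5); and `ω(⟨b_v⟩) · χ(ι_v b_v) = 1` (§3). [cite: Rogawski1990, §13.8 p. 216] [cite: Weil1956, §1] -/
theorem key_of_complexConj_eq
    (hur : ∀ u : HeightOneSpectrum (𝓞 ↥(maximalRealSubfield L)), u ≠ v → ∀ W : UnitaryGroup.PlacesOver L u,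
      Algebra.IsUnramifiedAt (𝓞 ↥(maximalRealSubfield L)) W.1.asIdeal)
    (w : UnitaryGroup.PlacesOver L v) (hw : IsCMField.complexConj L • w.1 = w.1)
    (χ : (UnitaryGroup.LocalRing L v)ˣ →* ℂˣ) (hχ : IsQuadraticCharExtension (conjLocal L (IsCMField.complexConj L) v) χ)
    (Φinf : (InfiniteAdeleRing L)ˣ →* ℂˣ)
    (hΦ : ∀ a : ideleGroup ↥(maximalRealSubfield L),
      Φinf (infPart L (AdeleRing.ideleBaseChange ↥(maximalRealSubfield L) L a)) =
        quadraticHeckeCharCM L (infiniteIdeles ↥(maximalRealSubfield L) (infPart ↥(maximalRealSubfield L) a)))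
    {a : ideleGroup ↥(maximalRealSubfield L)} {y : ideleGroup L} {k : Lˣ} (hy : y ∈ unitIdelesAway w.1)
    (h : AdeleRing.ideleBaseChange ↥(maximalRealSubfield L) L a * y = Literature.NumberTheory.GaloisRepresentations.principalIdele L k)
    (hk : IsCMField.complexConj L (k : L) = k) :
    (quadraticHeckeCharCM L a : ℂ) * ((Φinf (infPart L y) : ℂ) *
      χ ((MulEquiv.piUnits (M := fun w' : UnitaryGroup.PlacesOver L v => w'.1.adicCompletion L)).symm (Pi.mulSingle w (cpt w.1 y)))) = 1 := by
  haveI : Algebra.IsQuadraticExtension ↥(maximalRealSubfield L) L := IsCMField.isQuadraticExtension L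
  have hsub : ∀ w' : UnitaryGroup.PlacesOver L v, w' = w :=
    UnitaryGroup.PlacesOver.eq_of_smul_eq (IsCMField.complexConj L) (IsCMField.complexConj_ne_one L) w hw
  set F := ↥(maximalRealSubfield L) with hFdef
  set BC := AdeleRing.ideleBaseChange F L with hBC
  set ω := quadraticHeckeCharCM L with hω
  -- `k ∈ L⁺`: `k = algebraMap k₀`
  have hkmem : (k : L) ∈ maximalRealSubfield L := (IsCMField.complexConj_eq_self_iff L (k : L)).1 hk
  have hk0 : (⟨(k : L), hkmem⟩ : F) ≠ 0 := fun h0 => k.ne_zero (congrArg Subtype.val h0)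
  set k₀ : Fˣ := Units.mk0 ⟨(k : L), hkmem⟩ hk0 with hk₀
  have hkk : Units.map (algebraMap F L : F →* L) k₀ = k := Units.ext rfl
  -- `y = b_L`, `b = a⁻¹ (k₀)`; `ω a = (ω b)⁻¹`
  set b : ideleGroup F := a⁻¹ * Literature.NumberTheory.GaloisRepresentations.principalIdele F k₀ with hb
  have hyb : y = BC b := by
    rw [hb, map_mul, map_inv, ← principalIdele_algebraMap, hkk, ← h, inv_mul_cancel_left]
  have hωa : (ω a : ℂˣ) = (ω b)⁻¹ := by
    rw [hb, map_mul, map_inv, ω.map_principal (Literature.NumberTheory.GaloisRepresentations.principalIdele_mem k₀), mul_one, inv_inv]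
  -- decompose `b = b_∞ · b^∞`, `b^∞ = ⟨β⟩_v · b′`
  set binf : ideleGroup F := infiniteIdeles F (infPart F b) with hbinf
  set bf : ideleGroup F := binf⁻¹ * b with hbf
  obtain ⟨hbf1, hbf2⟩ := infiniteIdeles_infPart_inv_mul b
  set β : (v.adicCompletion F)ˣ := cpt v b with hβ
  have hβv : ((β : (v.adicCompletion F)ˣ) : v.adicCompletion F) = (b : AdeleRing (𝓞 F) F).2 v := rfl
  set b' : ideleGroup F := (localUnits v β)⁻¹ * bf with hb'
  have hb_eq : b = binf * (localUnits v β * b') := by rw [hb', mul_inv_cancel_left, hbf, mul_inv_cancel_left]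
  -- `b′ ∈ 𝕌_{L⁺}`, `b′_∞ = 1`, `b′_v = 1`
  have hb'1 : (b' : AdeleRing (𝓞 F) F).1 = 1 := by
    rw [hb', ideleGroup_val_fst_mul, hbf1, mul_one]
    have h1 := ideleGroup_val_inv_fst_mul (localUnits v β)
    rwa [localUnits_fst, mul_one] at h1
  have hb'v : (b' : AdeleRing (𝓞 F) F).2 v = 1 := by
    rw [hb', ideleGroup_val_snd_mul, ideleGroup_val_inv_snd, localUnits_snd_apply_self, hbf2, ← hβv, inv_mul_cancel₀]
    exact Units.ne_zero β
  have hb'u : b' ∈ unitIdeles F := by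
    intro u
    by_cases hu : u = v
    · rw [hu, hb'v, map_one]
    · rw [hb', ideleGroup_val_snd_mul, ideleGroup_val_inv_snd, localUnits_snd_apply_of_ne β hu, inv_one, one_mul, hbf2]
      exact valued_snd_eq_one_of_ideleBaseChange_mem_unitIdelesAway L v w (a := b) (by rw [← hBC, ← hyb]; exact hy) hu
  have hωb' : ω b' = 1 := quadraticHeckeCharCM_eq_one_of_unit_off L v hur b' hb'1 hb'u hb'v
  -- `ω b = ω b_∞ · ω ⟨β⟩_v`
  have hωb : ω b = ω binf * ω (localUnits v β) := by
    rw [hb_eq, map_mul, map_mul, hωb', mul_one]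
  -- `Φ_∞(y_∞) = ω(b_∞)`: `y_∞ = (b_L)_∞ = ((b_∞)_L)_∞`
  have hinfb : infPart L (BC b) = infPart L (BC binf) := by
    apply Units.ext
    rw [val_infPart, val_infPart, hBC, AdeleRing.coe_ideleBaseChange, AdeleRing.coe_ideleBaseChange, AdeleRing.baseChange_fst,
      AdeleRing.baseChange_fst, hbinf, infiniteIdeles_fst, val_infPart]
  have hΦy : Φinf (infPart L y) = ω binf := by
    rw [hyb, hinfb, hBC, hΦ, infPart_infiniteIdeles]
  -- `blk_w(y) = ι_v(β)`: the `w`-component of `b_L` is `ι_w(b_v)`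
  have hblk : (MulEquiv.piUnits (M := fun w' : UnitaryGroup.PlacesOver L v => w'.1.adicCompletion L)).symm (Pi.mulSingle w (cpt w.1 y)) =
      Units.map (UnitaryGroup.toLocalRing L v : v.adicCompletion F →* UnitaryGroup.LocalRing L v) β := by
    rw [hyb, hBC, piUnits_symm_mulSingle_cpt_ideleBaseChange L v w hsub b]
  -- assemble: `ω(a) Φ(y_∞) χ(blk y) = (ω b_∞ ω⟨β⟩)⁻¹ ω b_∞ (χ ι β) = ω⟨β⟩⁻¹ χ(ι β) = ω⟨β⟩ χ(ι β) = 1`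
  have hloc : ω (localUnits v β) *
      χ (Units.map (UnitaryGroup.toLocalRing L v : v.adicCompletion F →* UnitaryGroup.LocalRing L v) β) = 1 := by
    rw [← Units.val_eq_one, Units.val_mul, hω]
    exact quadraticHeckeCharCM_localUnits_mul_eq_one L v χ hχ β
  have hsq : (ω (localUnits v β) : ℂˣ)⁻¹ = ω (localUnits v β) := by
    rw [inv_eq_iff_mul_eq_one, ← pow_two, hω, quadraticHeckeCharCM_apply_sq]
  rw [← Units.val_mul, ← Units.val_mul, Units.val_eq_one, hΦy, hblk, hωa, hωb, mul_inv_rev, mul_assoc, inv_mul_cancel_left, hsq]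
  exact hloc

end Summit.HodgeConjecture.HodgeConjecture.R90.S3

end
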